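import Summits.AtomisticToContinuum.HydrodynamicLimit.Theorems.CollisionIsometryCLTAdaptedWeightCLTTLReductionMeasurable
import Summits.AtomisticToContinuum.HydrodynamicLimit.Theorems.CollisionIsometryCLTAdaptedWeightCLTTLReductionFlow
import Summits.AtomisticToContinuum.HydrodynamicLimit.Theorems.CollisionIsometryCLTAdaptedWeightCLTTLReductionDictionary
import Literature.MathematicalPhysics.KineticTheory.HardSphereTwoTimePressure

/-!
# Stub `stub_reduction` of the line `contact-source-duhamel` (file 6/6: the reduction)
(crux `CollisionIsometryCLT.AdaptedWeightCLT`, stmt-AtomisticToContinuum-14868 = rev-12 TIME-LOCAL crux; `--supports`)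

REDUCTION (measure theory). For `0 < σ < 1/2`, the Duhamel identity, the flow dictionary and, at a horizon
`t > 0`, past damping, contact-cross-null and source contraction on `[0, t]` imply the crux's conclusion on
`[0, t]` (`ConclOn … t`, the crux's event verbatim). Proof, for an admissible kernel family and `δ > 0`,
at fixed `N`:
1. DICTIONARY (`cruxIntegrand_eq`, every `s z x`): the crux's integrand `Σ_{jk} D² + |q|²` IS `DefectSq`, so
   the crux's event is `{δ < ∫₀ᵗ∫ₓ DefectSq}`.
2. GOOD SET `G_N = {z ∈ Φ.good | the dictionary identity holds at z for all s, Δ ≥ 0}`: it carries full local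
   Gibbs measure (`HardSphereFlow.ae_mem_good`, `FlowDictionary`, `localGibbsLaw ≪ liouville`).
3. INTEGRABILITY BOOKKEEPING: on `G_N` the four functionals `DefectSq, PastSq, XiDevSq, XiCorr` are bounded on
   `[0, t] × 𝕋³` (velocity radius `vR z`, kernel bound, collision budget of the orbit: `…TLReductionFlow`) and
   jointly measurable in `(s, x)` (`…TLReductionMeasurable`), hence have genuine iterated integrals
   (`integrable_of_bdd`: `Integrable.of_bound`, `StronglyMeasurable.integral_prod_right'`; the torus geometry
   is regular at diameter `hsDiameter σ N ≤ σ < 1/2`),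
   so the pointwise Peter–Paul inequality `DefectSq ≤ 2η DefectSq + (4η)⁻¹(PastSq + XiDevSq) + XiCorr`
   (`defectSq_le`, `η = (1 − κ)/4`) integrates to `I_D ≤ 2η I_D + (4η)⁻¹ (I_P + I_V) + I_X`.
4. Outside the three bad events `{δ₁ < I_P}`, `{δ₁ < I_V}`, `{κ I_D + δ₃ < I_X}` (`δ₁ = (1−κ)²δ/8`,
   `δ₃ = (1−κ)δ/4`) this gives `(1 − κ) I_D ≤ (1 − κ) δ`, i.e. the crux's event fails; hence the crux's event
   lies in `G_Nᶜ ∪ bad₁ ∪ bad₂ ∪ bad₃`, of measure `≤ 0 + o(1) + o(1) + o(1)` (monotonicity and subadditivity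
   of the outer measure — no measurability of the events is needed), and the squeeze concludes.
`TailsOn` and `NiceProfiles` are hypotheses of the registered signature that this proof does not need
(the tails enter through `PastSmallOn`/`CrossNullOn`/`SourceContractionOn`).
-/

namespace Summit.AtomisticToContinuum.HydrodynamicLimit.Theorems.ContactSourceDuhamel.TimeLocal.Reduction

open scoped BigOperators Topology Classical MeasureTheory ENNReal InnerProductSpace
open Filter Set MeasureTheory
open Literature.Analysis.FluidPDE
open Literature.MathematicalPhysics.KineticTheory (hsDiameter hsDiameter_le localGibbsLaw
  localGibbsLaw_absolutelyContinuous)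

noncomputable section

variable {σ : ℝ} {N : ℕ} {r : ℕ}

/-! ## Bounded functions on `[0, t] × 𝕋³` (closure under the finite algebra of the line) -/

section Bdd

variable {t : ℝ}

/-- Sums of bounded functions are bounded. -/
theorem bdd_add {F G : ℝ → T3 → ℝ} (hF : ∃ B, ∀ s ∈ Icc 0 t, ∀ x, |F s x| ≤ B)
    (hG : ∃ B, ∀ s ∈ Icc 0 t, ∀ x, |G s x| ≤ B) : ∃ B, ∀ s ∈ Icc 0 t, ∀ x, |F s x + G s x| ≤ B := by
  obtain ⟨B₁, h₁⟩ := hF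
  obtain ⟨B₂, h₂⟩ := hG
  exact ⟨B₁ + B₂, fun s hs x => (abs_add_le _ _).trans (add_le_add (h₁ s hs x) (h₂ s hs x))⟩

/-- Differences of bounded functions are bounded. -/
theorem bdd_sub {F G : ℝ → T3 → ℝ} (hF : ∃ B, ∀ s ∈ Icc 0 t, ∀ x, |F s x| ≤ B)
    (hG : ∃ B, ∀ s ∈ Icc 0 t, ∀ x, |G s x| ≤ B) : ∃ B, ∀ s ∈ Icc 0 t, ∀ x, |F s x - G s x| ≤ B := by
  obtain ⟨B₁, h₁⟩ := hF
  obtain ⟨B₂, h₂⟩ := hG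
  exact ⟨B₁ + B₂, fun s hs x => (abs_sub _ _).trans (add_le_add (h₁ s hs x) (h₂ s hs x))⟩

/-- Products of bounded functions are bounded. -/
theorem bdd_mul {F G : ℝ → T3 → ℝ} (hF : ∃ B, ∀ s ∈ Icc 0 t, ∀ x, |F s x| ≤ B)
    (hG : ∃ B, ∀ s ∈ Icc 0 t, ∀ x, |G s x| ≤ B) : ∃ B, ∀ s ∈ Icc 0 t, ∀ x, |F s x * G s x| ≤ B := by
  obtain ⟨B₁, h₁⟩ := hF
  obtain ⟨B₂, h₂⟩ := hG
  refine ⟨B₁ * B₂, fun s hs x => ?_⟩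
  rw [abs_mul]
  exact mul_le_mul (h₁ s hs x) (h₂ s hs x) (abs_nonneg _) ((abs_nonneg _).trans (h₁ s hs x))

/-- Finite sums of bounded functions are bounded. -/
theorem bdd_sum {ι : Type*} (S : Finset ι) {F : ι → ℝ → T3 → ℝ}
    (h : ∀ i ∈ S, ∃ B, ∀ s ∈ Icc 0 t, ∀ x, |F i s x| ≤ B) :
    ∃ B, ∀ s ∈ Icc 0 t, ∀ x, |∑ i ∈ S, F i s x| ≤ B := by
  classical
  induction S using Finset.induction_on with
  | empty => exact ⟨0, fun s _ x => by simp⟩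
  | insert a S ha ih =>
    obtain ⟨B₁, h₁⟩ := h a (Finset.mem_insert_self a S)
    obtain ⟨B₂, h₂⟩ := ih fun i hi => h i (Finset.mem_insert_of_mem hi)
    refine ⟨B₁ + B₂, fun s hs x => ?_⟩
    rw [Finset.sum_insert ha]
    exact (abs_add_le _ _).trans (add_le_add (h₁ s hs x) (h₂ s hs x))

end Bdd

/-! ## The four functionals along a good orbit are bounded on `[0, t] × 𝕋³` -/

section Orbit

variable {Φ : Flow σ N} {z : Cfg N} {φ : ℕ → T3 → ℝ} {Cφ t : ℝ}

/-- The block moments are bounded along a good orbit. -/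
theorem bdd_blkFlow (hz : z ∈ Φ.good) (hφ0 : ∀ y, 0 ≤ φ N y) (hφC : ∀ y, φ N y ≤ Cφ) (C : Tens r) :
    ∃ B, ∀ s ∈ Icc 0 t, ∀ x, |blkFlow r σ N Φ φ s z x C| ≤ B :=
  ⟨Cφ * (cT r * ‖C‖ * (2 * vR z) ^ r), fun s _ x =>
    abs_blkFlow_le Φ φ s z x C ((hφ0 _).trans (hφC ((Φ.flow s z 0).1 - x)))
      (fun i => by rw [wgt, abs_of_nonneg (hφ0 _)]; exact hφC _) (norm_vel_flow_le Φ hz s)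
      (norm_ubar_le Φ φ s z x (vR_nonneg z) hφ0 (norm_vel_flow_le Φ hz s))⟩

/-- PAST along a good orbit is bounded on `[0, t] × 𝕋³`. -/
theorem bdd_pastF (hG : (Torus.geometry (Fin 3)).IsHardSphereRegular (hsDiameter σ N)) (hz : z ∈ Φ.good)
    (hφ0 : ∀ y, 0 ≤ φ N y) (hφC : ∀ y, φ N y ≤ Cφ) (C : Tens r) :
    ∃ B, ∀ s ∈ Icc 0 t, ∀ x, |pastF r σ N (winStart σ N Φ s z)
      (steps σ N (winStart σ N Φ s z) (winLen N s)) (wgt σ N Φ φ s z x) (ubar σ N Φ φ s z x) C| ≤ B :=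
  ⟨Cφ * (cT r * ‖C‖ * (KT r ^ ((Φ.isTrajectory z hz).locFinite 0 t).toFinset.card * (2 * vR z) ^ r)),
    fun s hs x => abs_pastF_le_of _ _ _ _ C (vR_nonneg z) ((hφ0 _).trans (hφC ((Φ.flow s z 0).1 - x)))
      (fun i => by rw [wgt, abs_of_nonneg (hφ0 _)]; exact hφC _)
      (fun k => norm_vel_flow_le Φ hz _ k)
      (norm_ubar_le Φ φ s z x (vR_nonneg z) hφ0 (norm_vel_flow_le Φ hz s)) (steps_win_le hG Φ hz hs)⟩

/-- Ξ along a good orbit is bounded on `[0, t] × 𝕋³`. -/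
theorem bdd_xiF (hG : (Torus.geometry (Fin 3)).IsHardSphereRegular (hsDiameter σ N)) (hz : z ∈ Φ.good)
    (hφ0 : ∀ y, 0 ≤ φ N y) (hφC : ∀ y, φ N y ≤ Cφ) (C : Tens r) :
    ∃ B, ∀ s ∈ Icc 0 t, ∀ x, |xiF r σ N (winStart σ N Φ s z)
      (steps σ N (winStart σ N Φ s z) (winLen N s)) (wgt σ N Φ φ s z x) (ubar σ N Φ φ s z x) C| ≤ B :=
  ⟨((Φ.isTrajectory z hz).locFinite 0 t).toFinset.card * (Cφ * (cT r * ‖C‖ *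
      (KT r ^ ((Φ.isTrajectory z hz).locFinite 0 t).toFinset.card * (cS r * (4 * vR z) ^ r)))),
    fun s hs x => abs_xiF_le_of _ _ _ _ C (vR_nonneg z) ((hφ0 _).trans (hφC ((Φ.flow s z 0).1 - x)))
      (fun i => by rw [wgt, abs_of_nonneg (hφ0 _)]; exact hφC _)
      (fun l i => norm_velAfter_flow_le Φ hz _ l i)
      (norm_ubar_le Φ φ s z x (vR_nonneg z) hφ0 (norm_vel_flow_le Φ hz s)) (steps_win_le hG Φ hz hs)⟩

/-- Ξ^ch along a good orbit is bounded on `[0, t] × 𝕋³`. -/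
theorem bdd_xiChF (hG : (Torus.geometry (Fin 3)).IsHardSphereRegular (hsDiameter σ N)) (hz : z ∈ Φ.good)
    (hφ0 : ∀ y, 0 ≤ φ N y) (hφC : ∀ y, φ N y ≤ Cφ) (C : Tens r) :
    ∃ B, ∀ s ∈ Icc 0 t, ∀ x, |xiChF r σ N (winStart σ N Φ s z)
      (steps σ N (winStart σ N Φ s z) (winLen N s)) (wgt σ N Φ φ s z x) (ubar σ N Φ φ s z x) C| ≤ B :=
  ⟨((Φ.isTrajectory z hz).locFinite 0 t).toFinset.card * (Cφ * (cT r * ‖C‖ *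
      (KT r ^ ((Φ.isTrajectory z hz).locFinite 0 t).toFinset.card * (cS r * (4 * vR z) ^ r)))),
    fun s hs x => abs_xiChF_le_of _ _ _ _ C (vR_nonneg z) ((hφ0 _).trans (hφC ((Φ.flow s z 0).1 - x)))
      (fun i => by rw [wgt, abs_of_nonneg (hφ0 _)]; exact hφC _) (fun i => hφ0 _)
      (fun l i => norm_velAfter_flow_le Φ hz _ l i)
      (norm_ubar_le Φ φ s z x (vR_nonneg z) hφ0 (norm_vel_flow_le Φ hz s)) (steps_win_le hG Φ hz hs)⟩

/-- `DefectSq` along a good orbit is bounded on `[0, t] × 𝕋³`. -/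
theorem bdd_defectSq (hz : z ∈ Φ.good) (hφ0 : ∀ y, 0 ≤ φ N y) (hφC : ∀ y, φ N y ≤ Cφ) :
    ∃ B, ∀ s ∈ Icc 0 t, ∀ x, |DefectSq σ N Φ φ s z x| ≤ B := by
  unfold DefectSq
  exact bdd_add (bdd_sum _ fun j _ => bdd_sum _ fun k _ => by
      simpa only [sq] using bdd_mul (bdd_blkFlow hz hφ0 hφC (C2 j k)) (bdd_blkFlow hz hφ0 hφC (C2 j k)))
    (bdd_sum _ fun a _ => by
      simpa only [sq] using bdd_mul (bdd_blkFlow hz hφ0 hφC (C3 a)) (bdd_blkFlow hz hφ0 hφC (C3 a)))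

/-- `PastSq` along a good orbit is bounded on `[0, t] × 𝕋³`. -/
theorem bdd_pastSq (hG : (Torus.geometry (Fin 3)).IsHardSphereRegular (hsDiameter σ N)) (hz : z ∈ Φ.good)
    (hφ0 : ∀ y, 0 ≤ φ N y) (hφC : ∀ y, φ N y ≤ Cφ) :
    ∃ B, ∀ s ∈ Icc 0 t, ∀ x, |PastSq σ N Φ φ s z x| ≤ B := by
  unfold PastSq
  exact bdd_add (bdd_sum _ fun j _ => bdd_sum _ fun k _ => by
      simpa only [sq] using bdd_mul (bdd_pastF hG hz hφ0 hφC (C2 j k)) (bdd_pastF hG hz hφ0 hφC (C2 j k)))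
    (bdd_sum _ fun a _ => by
      simpa only [sq] using bdd_mul (bdd_pastF hG hz hφ0 hφC (C3 a)) (bdd_pastF hG hz hφ0 hφC (C3 a)))

/-- `XiDevSq` along a good orbit is bounded on `[0, t] × 𝕋³`. -/
theorem bdd_xiDevSq (hG : (Torus.geometry (Fin 3)).IsHardSphereRegular (hsDiameter σ N)) (hz : z ∈ Φ.good)
    (hφ0 : ∀ y, 0 ≤ φ N y) (hφC : ∀ y, φ N y ≤ Cφ) :
    ∃ B, ∀ s ∈ Icc 0 t, ∀ x, |XiDevSq σ N Φ φ s z x| ≤ B := by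
  unfold XiDevSq
  exact bdd_add (bdd_sum _ fun j _ => bdd_sum _ fun k _ => by
      simpa only [sq] using bdd_mul
        (bdd_sub (bdd_xiF hG hz hφ0 hφC (C2 j k)) (bdd_xiChF hG hz hφ0 hφC (C2 j k)))
        (bdd_sub (bdd_xiF hG hz hφ0 hφC (C2 j k)) (bdd_xiChF hG hz hφ0 hφC (C2 j k))))
    (bdd_sum _ fun a _ => by
      simpa only [sq] using bdd_mul
        (bdd_sub (bdd_xiF hG hz hφ0 hφC (C3 a)) (bdd_xiChF hG hz hφ0 hφC (C3 a)))
        (bdd_sub (bdd_xiF hG hz hφ0 hφC (C3 a)) (bdd_xiChF hG hz hφ0 hφC (C3 a))))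

/-- `XiCorr` along a good orbit is bounded on `[0, t] × 𝕋³`. -/
theorem bdd_xiCorr (hG : (Torus.geometry (Fin 3)).IsHardSphereRegular (hsDiameter σ N)) (hz : z ∈ Φ.good)
    (hφ0 : ∀ y, 0 ≤ φ N y) (hφC : ∀ y, φ N y ≤ Cφ) :
    ∃ B, ∀ s ∈ Icc 0 t, ∀ x, |XiCorr σ N Φ φ s z x| ≤ B := by
  unfold XiCorr
  exact bdd_add (bdd_sum _ fun j _ => bdd_sum _ fun k _ =>
      bdd_mul (bdd_blkFlow hz hφ0 hφC (C2 j k)) (bdd_xiChF hG hz hφ0 hφC (C2 j k)))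
    (bdd_sum _ fun a _ => bdd_mul (bdd_blkFlow hz hφ0 hφC (C3 a)) (bdd_xiChF hG hz hφ0 hφC (C3 a)))

end Orbit

/-! ## Integrability -/

/-- The Haar measure of `𝕋³` is finite (the `Fin 3` instance of
`Literature.NumberTheory.DiophantineApproximation.KroneckerWeyl.isProbabilityMeasure_volume_unitAddTorus`,
re-derived in two lines from `volume_pi` to avoid importing the Kronecker–Weyl module here). -/
theorem isFiniteMeasure_volume_T3 : IsFiniteMeasure (volume : Measure T3) := by
  rw [volume_pi]
  infer_instance

/-- **A bounded, jointly measurable function on `[0, t] × 𝕋³` has genuine iterated integrals**: `x ↦ F s x` is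
integrable for every `s ∈ [0, t]` and `s ↦ ∫ x, F s x` is integrable on `[0, t]`. -/
theorem integrable_of_bdd (t : ℝ) (F : ℝ → T3 → ℝ) (hm : Measurable fun p : ℝ × T3 => F p.1 p.2)
    (hb : ∃ B, ∀ s ∈ Icc 0 t, ∀ x, |F s x| ≤ B) :
    (∀ s ∈ Icc 0 t, Integrable (F s)) ∧ IntegrableOn (fun s => ∫ x, F s x) (Icc 0 t) := by
  haveI := isFiniteMeasure_volume_T3
  obtain ⟨B, hB⟩ := hb
  refine ⟨fun s hs => ?_, ?_⟩
  · have hms : Measurable (F s) := (hm.comp (measurable_const.prodMk measurable_id) :)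
    exact Integrable.of_bound hms.aestronglyMeasurable B
      (ae_of_all _ fun x => by rw [Real.norm_eq_abs]; exact hB s hs x)
  · have hsm : StronglyMeasurable fun s => ∫ x, F s x := hm.stronglyMeasurable.integral_prod_right'
    refine IntegrableOn.of_bound measure_Icc_lt_top hsm.aestronglyMeasurable.restrict
      (B * (volume : Measure T3).real univ) ?_
    refine (ae_restrict_iff' measurableSet_Icc).2 (ae_of_all _ fun s hs => ?_)
    exact norm_integral_le_of_norm_le_const (ae_of_all _ fun x => by
      rw [Real.norm_eq_abs]; exact hB s hs x)

/-- Integrating the pointwise reduction inequality `D ≤ a D + b (P + V) + X` against a measure for which all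
four functions are integrable. -/
theorem integral_reduction_le {α : Type*} [MeasurableSpace α] {μ : Measure α} {D P V X : α → ℝ}
    {a b : ℝ} (hD : Integrable D μ) (hP : Integrable P μ) (hV : Integrable V μ) (hX : Integrable X μ)
    (h : ∀ᵐ y ∂μ, D y ≤ a * D y + b * (P y + V y) + X y) :
    ∫ y, D y ∂μ ≤ a * ∫ y, D y ∂μ + b * (∫ y, P y ∂μ + ∫ y, V y ∂μ) + ∫ y, X y ∂μ := by
  have h1 : Integrable (fun y => a * D y) μ := hD.const_mul a
  have h2 : Integrable (fun y => b * (P y + V y)) μ := (hP.add hV).const_mul b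
  calc ∫ y, D y ∂μ ≤ ∫ y, (a * D y + b * (P y + V y) + X y) ∂μ :=
        integral_mono_ae hD ((h1.add h2).add hX) h
    _ = a * ∫ y, D y ∂μ + b * (∫ y, P y ∂μ + ∫ y, V y ∂μ) + ∫ y, X y ∂μ := by
        rw [integral_add (f := fun y => a * D y + b * (P y + V y)) (g := X) (h1.add h2) hX,
          integral_add h1 h2, integral_const_mul, integral_const_mul, integral_add hP hV]


/-- **The integrated reduction inequality on the good set.** For a good datum `z` at which the flow
dictionary holds, an admissible (continuous, nonnegative, bounded) kernel and `η > 0`: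
`I_D ≤ 2η I_D + (4η)⁻¹ (I_P + I_V) + I_X` for the iterated integrals over `[0, t] × 𝕋³` of
`DefectSq, PastSq, XiDevSq, XiCorr`. -/
theorem setIntegral_defectSq_le (hG : (Torus.geometry (Fin 3)).IsHardSphereRegular (hsDiameter σ N))
    (hDu : DuhamelIdentity σ) {Φ : Flow σ N} {z : Cfg N} (hz : z ∈ Φ.good)
    (hdict : ∀ s Δ : ℝ, 0 ≤ Δ →
      (fun i => (Φ.flow (s + Δ) z i).2) = velAfter σ N (Φ.flow s z) (steps σ N (Φ.flow s z) Δ))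
    {φ : ℕ → T3 → ℝ} {Cφ : ℝ} (hφc : Continuous (φ N)) (hφ0 : ∀ y, 0 ≤ φ N y) (hφC : ∀ y, φ N y ≤ Cφ)
    {η : ℝ} (hη : 0 < η) (t : ℝ) :
    ∫ s in Icc 0 t, ∫ x, DefectSq σ N Φ φ s z x ≤
      2 * η * (∫ s in Icc 0 t, ∫ x, DefectSq σ N Φ φ s z x) +
        (4 * η)⁻¹ * ((∫ s in Icc 0 t, ∫ x, PastSq σ N Φ φ s z x) +
          ∫ s in Icc 0 t, ∫ x, XiDevSq σ N Φ φ s z x) +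
        ∫ s in Icc 0 t, ∫ x, XiCorr σ N Φ φ s z x := by
  have hD := integrable_of_bdd t (fun s x => DefectSq σ N Φ φ s z x)
    (measurable_defectSq hz hφc) (bdd_defectSq hz hφ0 hφC)
  have hP := integrable_of_bdd t (fun s x => PastSq σ N Φ φ s z x)
    (measurable_pastSq hG hz hφc) (bdd_pastSq hG hz hφ0 hφC)
  have hV := integrable_of_bdd t (fun s x => XiDevSq σ N Φ φ s z x)
    (measurable_xiDevSq hG hz hφc) (bdd_xiDevSq hG hz hφ0 hφC)
  have hX := integrable_of_bdd t (fun s x => XiCorr σ N Φ φ s z x)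
    (measurable_xiCorr hG hz hφc) (bdd_xiCorr hG hz hφ0 hφC)
  -- inner integrals, `s ∈ [0, t]`
  have hinner : ∀ s ∈ Icc 0 t, ∫ x, DefectSq σ N Φ φ s z x ≤
      2 * η * (∫ x, DefectSq σ N Φ φ s z x) +
        (4 * η)⁻¹ * ((∫ x, PastSq σ N Φ φ s z x) + ∫ x, XiDevSq σ N Φ φ s z x) +
        ∫ x, XiCorr σ N Φ φ s z x := fun s hs =>
    integral_reduction_le (hD.1 s hs) (hP.1 s hs) (hV.1 s hs) (hX.1 s hs)
      (ae_of_all _ fun x => defectSq_le hDu hdict φ hη s x)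
  -- outer integral
  exact integral_reduction_le hD.2 hP.2 hV.2 hX.2
    ((ae_restrict_iff' measurableSet_Icc).2 (ae_of_all _ hinner))

/-- **REDUCTION** (`stub_reduction` of the line `contact-source-duhamel`, registered signature): for
`0 < σ < 1/2`, the Duhamel identity, the flow dictionary and, at a horizon `t > 0`, past damping,
contact-cross-null and source contraction on `[0, t]` imply the crux's conclusion on `[0, t]`. See the module
docstring for the proof; `TailsOn` and `NiceProfiles` are not used. -/
theorem stub_reduction :
    ∀ σ : ℝ, 0 < σ → σ < 2⁻¹ → DuhamelIdentity σ → FlowDictionary σ →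
      ∀ (a₀ θ₀ : T3 → ℝ) (u₀ : T3 → V3), NiceProfiles a₀ θ₀ u₀ → ∀ Φ : Flows σ,
        ∀ t : ℝ, 0 < t → TailsOn σ a₀ θ₀ u₀ Φ t → PastSmallOn σ a₀ θ₀ u₀ Φ t →
          CrossNullOn σ a₀ θ₀ u₀ Φ t → SourceContractionOn σ a₀ θ₀ u₀ Φ t →
            ConclOn σ a₀ θ₀ u₀ Φ t := by
  intro σ hσ hσ2 hDu hFD a₀ θ₀ u₀ _ Φ t _ _ hPast hCross hSrc γ C φ hγ hγ' hadm ρb mb ub D q δ hδ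
  obtain ⟨κ, hκ, hSrcκ⟩ := hSrc γ C φ hγ hγ' hadm
  have h1κ : 0 < 1 - κ := by linarith
  have hη : 0 < (1 - κ) / 4 := by positivity
  have hδ₁ : 0 < (1 - κ) ^ 2 * δ / 8 := by positivity
  have hδ₃ : 0 < (1 - κ) * δ / 4 := by positivity
  have hB1 := hPast γ C φ hγ hγ' hadm _ hδ₁
  have hB2 := hCross γ C φ hγ hγ' hadm _ hδ₁
  have hB3 := hSrcκ _ hδ₃
  refine tendsto_of_tendsto_of_tendsto_of_le_of_le tendsto_const_nhds
    (by simpa using (hB1.add hB2).add hB3) (fun _ => zero_le) fun n => ?_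
  -- fixed `n`: the crux's event lies in `(good ∩ dictionary)ᶜ ∪ bad₁ ∪ bad₂ ∪ bad₃`
  have hG : (Torus.geometry (Fin 3)).IsHardSphereRegular (hsDiameter σ n) :=
    Torus.isHardSphereRegular_geometry ((hsDiameter_le hσ.le n).trans_lt hσ2)
  have hφc : Continuous (φ n) := (hadm.1 n).continuous
  have hφ0 : ∀ y, 0 ≤ φ n y := hadm.2.1 n
  have hφC : ∀ y, φ n y ≤ C * ((n : ℝ) + 1) ^ (3 * γ) := hadm.2.2.2.2.1 n
  -- step 1: the crux integrand is `DefectSq`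
  have hint : ∀ s z x, ((∑ j, ∑ k, D n s z x j k ^ 2) + ‖q n s z x‖ ^ 2) =
      DefectSq σ n (Φ n) φ s z x := fun s z x => cruxIntegrand_eq (Φ n) φ s z x
  simp only [hint]
  -- step 2: the good set
  set Gd : Set (Cfg n) := {z | z ∈ (Φ n).good ∧ ∀ s Δ : ℝ, 0 ≤ Δ →
    (fun i => ((Φ n).flow (s + Δ) z i).2) =
      velAfter σ n ((Φ n).flow s z) (steps σ n ((Φ n).flow s z) Δ)} with hGd
  have hnull : localGibbsLaw σ a₀ u₀ θ₀ n (Φ n) Gdᶜ = 0 := by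
    have hae : ∀ᵐ z ∂(localGibbsLaw σ a₀ u₀ θ₀ n (Φ n)), z ∈ Gd :=
      (localGibbsLaw_absolutelyContinuous σ a₀ u₀ θ₀ n (Φ n)).ae_le
        (((Φ n).ae_mem_good).and (hFD n (Φ n)))
    exact ae_iff.1 hae
  -- steps 3–4: on the good set, outside the bad events, the crux's event fails
  have hsub : {z | δ < ∫ s in Icc 0 t, ∫ x, DefectSq σ n (Φ n) φ s z x} ⊆
      ((Gdᶜ ∪ {z | (1 - κ) ^ 2 * δ / 8 < ∫ s in Icc 0 t, ∫ x, PastSq σ n (Φ n) φ s z x}) ∪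
        {z | (1 - κ) ^ 2 * δ / 8 < ∫ s in Icc 0 t, ∫ x, XiDevSq σ n (Φ n) φ s z x}) ∪
        {z | κ * (∫ s in Icc 0 t, ∫ x, DefectSq σ n (Φ n) φ s z x) + (1 - κ) * δ / 4 <
          ∫ s in Icc 0 t, ∫ x, XiCorr σ n (Φ n) φ s z x} := by
    intro z hzE
    by_contra hnot
    simp only [mem_union, mem_compl_iff, mem_setOf_eq, not_or, not_not, not_lt] at hnot
    obtain ⟨⟨⟨hzG, hIP⟩, hIV⟩, hIX⟩ := hnot
    have hmain := setIntegral_defectSq_le hG hDu hzG.1 hzG.2 hφc hφ0 hφC hη t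
    set ID := ∫ s in Icc 0 t, ∫ x, DefectSq σ n (Φ n) φ s z x with hID
    set IP := ∫ s in Icc 0 t, ∫ x, PastSq σ n (Φ n) φ s z x with hIPd
    set IV := ∫ s in Icc 0 t, ∫ x, XiDevSq σ n (Φ n) φ s z x with hIVd
    set IX := ∫ s in Icc 0 t, ∫ x, XiCorr σ n (Φ n) φ s z x with hIXd
    set W := (4 * ((1 - κ) / 4))⁻¹ * (IP + IV) with hW
    have hWle : W ≤ (1 - κ) * δ / 4 := by
      have h4 : (4 * ((1 - κ) / 4))⁻¹ = (1 - κ)⁻¹ := by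
        rw [mul_div_cancel₀ _ (four_ne_zero)]
      rw [hW, h4]
      calc (1 - κ)⁻¹ * (IP + IV) ≤ (1 - κ)⁻¹ * ((1 - κ) ^ 2 * δ / 8 + (1 - κ) ^ 2 * δ / 8) :=
            mul_le_mul_of_nonneg_left (add_le_add hIP hIV) (inv_nonneg.2 h1κ.le)
        _ = (1 - κ) * δ / 4 := by
            field_simp
            ring
    have hE : δ < ID := hzE
    have hkey : (1 - κ) * ID ≤ (1 - κ) * δ := by nlinarith
    exact (not_le.2 hE) (le_of_mul_le_mul_left hkey h1κ)
  calc localGibbsLaw σ a₀ u₀ θ₀ n (Φ n) {z | δ < ∫ s in Icc 0 t, ∫ x, DefectSq σ n (Φ n) φ s z x}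
      ≤ localGibbsLaw σ a₀ u₀ θ₀ n (Φ n)
          (((Gdᶜ ∪ {z | (1 - κ) ^ 2 * δ / 8 < ∫ s in Icc 0 t, ∫ x, PastSq σ n (Φ n) φ s z x}) ∪
            {z | (1 - κ) ^ 2 * δ / 8 < ∫ s in Icc 0 t, ∫ x, XiDevSq σ n (Φ n) φ s z x}) ∪
            {z | κ * (∫ s in Icc 0 t, ∫ x, DefectSq σ n (Φ n) φ s z x) + (1 - κ) * δ / 4 <
              ∫ s in Icc 0 t, ∫ x, XiCorr σ n (Φ n) φ s z x}) := measure_mono hsub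
    _ ≤ localGibbsLaw σ a₀ u₀ θ₀ n (Φ n) Gdᶜ +
          localGibbsLaw σ a₀ u₀ θ₀ n (Φ n)
            {z | (1 - κ) ^ 2 * δ / 8 < ∫ s in Icc 0 t, ∫ x, PastSq σ n (Φ n) φ s z x} +
          localGibbsLaw σ a₀ u₀ θ₀ n (Φ n)
            {z | (1 - κ) ^ 2 * δ / 8 < ∫ s in Icc 0 t, ∫ x, XiDevSq σ n (Φ n) φ s z x} +
          localGibbsLaw σ a₀ u₀ θ₀ n (Φ n)
            {z | κ * (∫ s in Icc 0 t, ∫ x, DefectSq σ n (Φ n) φ s z x) + (1 - κ) * δ / 4 <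
              ∫ s in Icc 0 t, ∫ x, XiCorr σ n (Φ n) φ s z x} :=
        (measure_union_le _ _).trans (add_le_add ((measure_union_le _ _).trans
          (add_le_add (measure_union_le _ _) le_rfl)) le_rfl)
    _ = _ := by rw [hnull, zero_add]

end

end Summit.AtomisticToContinuum.HydrodynamicLimit.Theorems.ContactSourceDuhamel.TimeLocal.Reduction
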